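import Mathlib.Tactic.Group
import Literature.AnabelianGeometry.SemiGraphs.ArithOuterActionOfGraphAction
import Literature.AnabelianGeometry.SemiGraphs.CoveringPullbackCompLaw
import HarnessLib

/-!
# [SemiAnbd] Def 5.1 (i) / Prop 5.2 (iv): the outer arithmetic action and its chart binders from a graph
# action presented WITH 2-cell data (every-`θ` forms of `ArithOuterActionOfGraphAction.lean`)

Mochizuki, *Semi-graphs of anabelioids*, Publ. RIMS **42** (2006), §5 Def 5.1 (i) p. 62 ("an action of
`π̂₁(A)` on `𝔾`"), Prop 5.2 (iv) p. 64; §3 Prop 3.6 (iv) p. 39, Prop 3.2 p. 35; Rmk 2.4.2 p. 26 (the 2-cells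
of a morphism of semi-graphs of anabelioids are DATA). [cite: MochizukiSemiAnbd2006, Def 5.1 (i), p. 62]

PROOF-ONLY file (no definition; cell abc-iut, seat abc-iut-L3-d6 gen 10, ROUTE T · «T54-B·WITH»).
abc-iut-w4-d082's `ArithOuterActionOfGraphAction.lean` derives, from a family `F : Π_A → Hom 𝒢 𝒢`, the OUTER
ACTION `ρ : Π_A → Out(π₁^temp 𝒢)` and the chart binders `hV` / `hE` / `hBR` of the Thm 5.4 producer chain (T54-B)
under pseudo-functoriality binders `hmul` / `hone` stated for the pull-backs glued along the CHOSEN 2-cells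
(`Hom.chartPullback c c = chartPullbackWith chosenConjugators`).  By cell finding d4-F3 / RQ12 (kernel witness
`ProfiniteSemiGraph.not_inducesOfCompatible`) pull-backs along different admissible families of 2-cells are in
general NOT isomorphic, and the chosen family of `F (a b)` is unrelated to those of `F a`, `F b`: in that form
`hmul` / `hone` are dischargeable only in degenerate cases (no edges; unique 2-cells).  This file restates the chain
for the pull-backs `(F a).chartPullbackWith (θ a) c c` along SUPPLIED 2-cells `θ a` (`Hom.ConjugatorFamily`), where
the binders ARE dischargeable — for STRICT actions with pasted 2-cells by abc-iut-L3-d6's composition / unit laws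
(`Hom.nonempty_chartPullbackWith_mul_iso` / `…_one_iso`, `CoveringPullbackCompLaw.lean`; the `…_of_strictGraphAction`
theorems below carry NO pull-back binder), for actions given up to conjugation by
`Hom.nonempty_chartPullbackWith_mul_iso_of_conj` / `…_one_iso_of_conj` (`CoveringPullbackConjInvariance.lean`).

* `map_mem_verticialSubgroups_of_chartPullbackWith_iso` / `…edgeLike…` / `exists_branchPair_of_chartPullbackWith_iso`:
  the binders `hV`, `hE`, `hBR` for ONE morphism `F` and a continuous `φ` with `F^*_θ ≅ B^temp(φ)` (Prop 3.6 (iv)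
  vertex/edge compatibility `Hom.conj_of_chartPullbackWith_iso(_edge)` + the branch square `θ.spec`);
* `exists_outerAction_of_graphActionWith`: Prop 3.6 (iv) (`Hom.exists_inducedHom_with`) + Prop 3.2
  (`exists_outerAction_of_resFamily`) ⟹ `∃ ρ : Π_A →* Out(π₁^temp 𝒢)` with representatives `Φ_a`,
  `(F a)^*_{θ a} ≅ B^temp(Φ_a)` — verbatim the input `hrep` of abc-iut-w5-d141's `hact_outerSemidirectProduct`;
* `exists_outerAction_binders_of_graphActionWith`, `exists_outerAction_arithChartAction_of_graphActionWith`,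
  `exists_arithTemperedGroup_of_graphActionWith`: the packaged binders, w4-d053's `ArithChartAction` at the outer
  semi-direct product model, T54-B minus topology (`exists_arithTemperedGroup_alg`); `…_of_strictGraphAction`: the
  same for a STRICT action `F (a b) = F b ≫ F a`, `F 1 = id` with pasted / trivial 2-cells — no `hmul` / `hone`.

Honest scope: the TEMPERED TOPOLOGY on `Π^temp_𝔊` stays producer debt (T54-B-top); w4-d082's chosen-2-cell forms
are untouched (they remain binders); no side taken on [IUTchIII] Cor 3.12; typed ≠ proved.
-/

namespace Literature.AnabelianGeometry.SemiGraphs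

open CategoryTheory Literature.AnabelianGeometry.EtaleTheta

universe u w

namespace ProfiniteSemiGraph

section Helpers

variable {G : Type*} [Group G]

/-- `h K h⁻¹ = K` for `h ∈ K`. [folklore] -/
private theorem map_conj_eq_self_of_mem' (K : Subgroup G) {h : G} (hh : h ∈ K) :
    K.map (MulAut.conj h).toMonoidHom = K := by
  ext x
  simp only [Subgroup.mem_map, MulEquiv.coe_toMonoidHom, MulAut.conj_apply]
  constructor
  · rintro ⟨k, hk, rfl⟩
    exact K.mul_mem (K.mul_mem hh hk) (K.inv_mem hh)
  · intro hx
    exact ⟨h⁻¹ * x * h, K.mul_mem (K.mul_mem (K.inv_mem hh) hx) hh, by group⟩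

/-- `y (x K x⁻¹) y⁻¹ = (y x) K (y x)⁻¹`. [folklore] -/
private theorem map_conj_map_conj₂ (K : Subgroup G) (x y : G) :
    (K.map (MulAut.conj x).toMonoidHom).map (MulAut.conj y).toMonoidHom =
      K.map (MulAut.conj (y * x)).toMonoidHom := by
  rw [Subgroup.map_map]
  congr 1
  ext t
  simp only [MonoidHom.coe_comp, MulEquiv.coe_toMonoidHom, Function.comp_apply, MulAut.conj_apply]
  group

/-- Pointwise conjugacy `α = conj(g) ∘ β ∘ f` with `f` surjective gives `range α = g (range β) g⁻¹`.
[folklore] -/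
private theorem range_eq_map_conj_of_surj' {K K' : Type*} [Group K] [Group K'] (α : K →* G) (β : K' →* G)
    (f : K → K') (hf : Function.Surjective f) (g : G) (h : ∀ x, α x = g * β (f x) * g⁻¹) :
    α.range = β.range.map (MulAut.conj g).toMonoidHom := by
  ext y
  simp only [MonoidHom.mem_range, Subgroup.mem_map, MulEquiv.coe_toMonoidHom, MulAut.conj_apply,
    exists_exists_eq_and]
  constructor
  · rintro ⟨x, rfl⟩
    exact ⟨f x, (h x).symm⟩
  · rintro ⟨x', rfl⟩
    obtain ⟨x, rfl⟩ := hf x'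
    exact ⟨x, h x⟩

/-- Subgroup version: `α(B) = g · β(f B) · g⁻¹`. [folklore] -/
private theorem map_eq_map_conj_of_surjOn' {K K' : Type*} [Group K] [Group K'] (α : K →* G)
    (β : K' →* G) (f : K → K') (g : G) (h : ∀ x, α x = g * β (f x) * g⁻¹) (B : Subgroup K)
    (B' : Subgroup K') (hBB' : f '' (B : Set K) = (B' : Set K')) :
    B.map α = (B'.map β).map (MulAut.conj g).toMonoidHom := by
  ext y
  simp only [Subgroup.mem_map, MulEquiv.coe_toMonoidHom, MulAut.conj_apply, exists_exists_and_eq_and]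
  constructor
  · rintro ⟨x, hx, rfl⟩
    refine ⟨f x, ?_, (h x).symm⟩
    have : f x ∈ f '' (B : Set K) := ⟨x, hx, rfl⟩
    rw [hBB'] at this
    exact this
  · rintro ⟨x', hx', rfl⟩
    have : x' ∈ f '' (B : Set K) := by rw [hBB']; exact hx'
    obtain ⟨x, hx, rfl⟩ := this
    exact ⟨x, hx, h x⟩

end Helpers

variable {𝒢 : ProfiniteSemiGraph.{u}} (c : TemperedPiChart 𝒢)

/-! ### The chart-compatibility binders for ONE morphism `F` with `F^*_θ ≅ B^temp(φ)` -/

section OneHom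

variable (F : Hom 𝒢 𝒢) (θ : F.ConjugatorFamily) (φ : c.G →ₜ* c.G)
  (hiso : Nonempty (F.chartPullbackWith θ c c ≅ BTemp.res φ))

include hiso in
/-- **Binder `hV` as a theorem, every-`θ` form**: a continuous `φ` with `F^*_θ ≅ B^temp(φ)` carries the verticial
subgroups at `v` to verticial subgroups at `F v` (Prop 3.6 (iv) vertex compatibility
`Hom.conj_of_chartPullbackWith_iso` + `F_v` onto). [cite: MochizukiSemiAnbd2006, Prop 3.6 (iv), p. 39] -/
theorem map_mem_verticialSubgroups_of_chartPullbackWith_iso (h36 : 𝒢.Prop36Hypotheses)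
    (hVs : ∀ v, Function.Surjective (F.hV v)) {v : 𝒢.graph.Vertex} {H : Subgroup c.G}
    (hH : H ∈ verticialSubgroups c v) :
    H.map φ.toMonoidHom ∈ verticialSubgroups c (F.base.vertexMap v) := by
  obtain ⟨ψ', hψ', rfl⟩ := hH
  obtain ⟨ψ, hψ⟩ := exists_isVerticialHom h36.isQuasiCoherent h36.isGaloisCountable c (F.base.vertexMap v)
  obtain ⟨g, hg⟩ := F.conj_of_chartPullbackWith_iso θ c c φ hiso v ψ' ψ hψ' hψ
  rw [MonoidHom.map_range]
  have : (φ.toMonoidHom.comp ψ'.toMonoidHom).range =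
      ψ.toMonoidHom.range.map (MulAut.conj g).toMonoidHom :=
    range_eq_map_conj_of_surj' _ _ (F.hV v) (hVs v) g (fun x => hg x)
  rw [this]
  exact conj_mem_verticialSubgroups c ⟨ψ, hψ, rfl⟩ g

include hiso in
/-- **Binder `hE` as a theorem, every-`θ` form**: the same for edge-like subgroups (edge compatibility
`Hom.conj_of_chartPullbackWith_iso_edge` + `F_e` onto; edge homomorphisms exist on a graph).
[cite: MochizukiSemiAnbd2006, Prop 3.6 (iv), p. 39] -/
theorem map_mem_edgeLikeSubgroups_of_chartPullbackWith_iso (h36 : 𝒢.Prop36Hypotheses)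
    (hG : 𝒢.graph.IsGraph) (hEs : ∀ e, Function.Surjective (F.hE e)) {e : 𝒢.graph.Edge}
    {K : Subgroup c.G} (hK : K ∈ edgeLikeSubgroups c e) :
    K.map φ.toMonoidHom ∈ edgeLikeSubgroups c (F.base.edgeMap e) := by
  obtain ⟨ψ', hψ', rfl⟩ := hK
  obtain ⟨ψ, hψ⟩ := exists_isEdgeHom_of_isGraph c h36 hG (F.base.edgeMap e)
  obtain ⟨g, hg⟩ := F.conj_of_chartPullbackWith_iso_edge θ c c φ hiso e ψ' ψ hψ' hψ
  rw [MonoidHom.map_range]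
  have : (φ.toMonoidHom.comp ψ'.toMonoidHom).range =
      ψ.toMonoidHom.range.map (MulAut.conj g).toMonoidHom :=
    range_eq_map_conj_of_surj' _ _ (F.hE e) (hEs e) g (fun x => hg x)
  rw [this]
  exact conj_mem_edgeLikeSubgroups' c ⟨ψ, hψ, rfl⟩ g

/-- The branch square of a morphism, on subgroups, for ANY 2-cell `θ_b`: `F_v(Π_b) = θ_b · Π_{F b} · θ_b⁻¹`
inside `Π_{F v}` when `F_e` is onto (`θ.spec`). [cite: MochizukiSemiAnbd2006, Rmk 2.4.2, p. 26] -/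
theorem map_branchSubgroup_eq_conj_of_conjugatorFamily (hEs : ∀ e, Function.Surjective (F.hE e))
    (b : 𝒢.graph.Branch) (v : 𝒢.graph.Vertex) (hb : 𝒢.graph.abuts b = some v) :
    (𝒢.branchSubgroup b v hb).map (F.hV v).toMonoidHom =
      (𝒢.branchSubgroup (F.base.branchMap b) (F.base.vertexMap v) (F.base.abuts_branchMap b v hb)).map
        (MulAut.conj (θ.θ b v hb)).toMonoidHom := by
  -- `branchSubgroup = range b_*`; `F_v ∘ b_* = conj(θ_b) ∘ (F b)_* ∘ F_e` pointwise
  have h := fun x => (θ.spec b v hb x).symm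
  unfold branchSubgroup
  rw [MonoidHom.map_range]
  have key : ((F.hV v).toMonoidHom.comp (𝒢.brHom b v hb).toMonoidHom).range =
      (𝒢.brHomAt (F.base.branchMap b) (F.base.vertexMap v) (F.base.abuts_branchMap b v hb)
          (F.base.edgeMap (𝒢.graph.edgeOf b)) (F.base.edgeOf_branchMap b)).toMonoidHom.range.map
        (MulAut.conj (θ.θ b v hb)).toMonoidHom :=
    range_eq_map_conj_of_surj' _ _ (F.hE (𝒢.graph.edgeOf b)) (hEs _) _ (fun x => h x)
  rw [key]
  congr 1
  -- `range (brHomAt … q) = range b'_*`: generalise the edge index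
  generalize F.base.edgeOf_branchMap b = q
  revert q
  generalize F.base.edgeMap (𝒢.graph.edgeOf b) = f
  intro q
  subst q
  rfl

include hiso in
/-- **Binder `hBR` as a theorem, every-`θ` form** (pair level): for a verticial `φᵥ` at `v` and a branch `b`
abutting to `v` there are a verticial `φ'` at `F v` and `x'` with `φ(φᵥ(Π_v)) = x' φ'(Π_{F v}) x'⁻¹` AND
`φ(φᵥ(Π_b)) = x' φ'(Π_{F b}) x'⁻¹` (`x' = y · φ'(θ_b)`: `y` from Prop 3.6 (iv) vertex compatibility, `θ_b` the
2-cell). [cite: MochizukiSemiAnbd2006, Prop 3.6 (iv), p. 39] -/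
theorem exists_branchPair_of_chartPullbackWith_iso (h36 : 𝒢.Prop36Hypotheses)
    (hVs : ∀ v, Function.Surjective (F.hV v)) (hEs : ∀ e, Function.Surjective (F.hE e))
    (b : 𝒢.graph.Branch) (v : 𝒢.graph.Vertex) (hb : 𝒢.graph.abuts b = some v)
    (φᵥ : 𝒢.Gv v →ₜ* c.G) (hφᵥ : IsVerticialHom c v φᵥ) :
    ∃ φ' : 𝒢.Gv (F.base.vertexMap v) →ₜ* c.G, IsVerticialHom c (F.base.vertexMap v) φ' ∧ ∃ x' : c.G,
      Subgroup.map φ.toMonoidHom φᵥ.toMonoidHom.range =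
        Subgroup.map (MulAut.conj x').toMonoidHom φ'.toMonoidHom.range ∧
      Subgroup.map φ.toMonoidHom (Subgroup.map φᵥ.toMonoidHom (𝒢.branchSubgroup b v hb)) =
        Subgroup.map (MulAut.conj x').toMonoidHom (Subgroup.map φ'.toMonoidHom
          (𝒢.branchSubgroup (F.base.branchMap b) (F.base.vertexMap v) (F.base.abuts_branchMap b v hb))) := by
  obtain ⟨φ', hφ'⟩ := exists_isVerticialHom h36.isQuasiCoherent h36.isGaloisCountable c (F.base.vertexMap v)
  obtain ⟨y, hy⟩ := F.conj_of_chartPullbackWith_iso θ c c φ hiso v φᵥ φ' hφᵥ hφ'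
  set g := θ.θ b v hb with hg
  refine ⟨φ', hφ', y * φ' g, ?_, ?_⟩
  · -- host part
    rw [MonoidHom.map_range]
    have : (φ.toMonoidHom.comp φᵥ.toMonoidHom).range =
        φ'.toMonoidHom.range.map (MulAut.conj y).toMonoidHom :=
      range_eq_map_conj_of_surj' _ _ (F.hV v) (hVs v) y (fun x => hy x)
    rw [this, ← map_conj_map_conj₂ _ (φ' g) y]
    congr 1
    exact (map_conj_eq_self_of_mem' _ (MonoidHom.mem_range.mpr ⟨g, rfl⟩)).symm
  · -- branch part: `φ(φᵥ(Π_b)) = y · φ'(F_v(Π_b)) · y⁻¹ = y · φ'(θ_b Π_{Fb} θ_b⁻¹) · y⁻¹`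
    rw [Subgroup.map_map]
    have h1 : Subgroup.map (φ.toMonoidHom.comp φᵥ.toMonoidHom) (𝒢.branchSubgroup b v hb) =
        ((Subgroup.map (F.hV v).toMonoidHom (𝒢.branchSubgroup b v hb)).map φ'.toMonoidHom).map
          (MulAut.conj y).toMonoidHom := by
      exact map_eq_map_conj_of_surjOn' _ _ (F.hV v) y (fun x => hy x) _ _ (Subgroup.coe_map _ _).symm
    rw [h1, map_branchSubgroup_eq_conj_of_conjugatorFamily F θ hEs b v hb, ← hg,
      Subgroup.map_map _ _ ((MulAut.conj g).toMonoidHom)]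
    -- `φ' ∘ conj g = conj (φ' g) ∘ φ'`
    have h2 : φ'.toMonoidHom.comp (MulAut.conj g).toMonoidHom =
        (MulAut.conj (φ' g)).toMonoidHom.comp φ'.toMonoidHom := by
      ext t; simp [MulAut.conj_apply, map_mul, map_inv]
    rw [h2, ← Subgroup.map_map, map_conj_map_conj₂]

end OneHom

/-! ### The outer action and its binders, from an action presented with 2-cell data -/

variable {PA : Type w} [Group PA] (F : PA → Hom 𝒢 𝒢) (θ : ∀ a, (F a).ConjugatorFamily)

/-- **The outer arithmetic action, every-`θ` form** (Def 5.1 (i) ⇒ Prop 5.2 (iv)'s outer representation):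
a family `F : Π_A → Hom 𝒢 𝒢` with 2-cell data `θ a` whose pull-back functors `(F a)^*_{θ a}` are pseudo-functorial
(`hmul`, `hone` — dischargeable: `Hom.nonempty_chartPullbackWith_mul_iso(_of_conj)` / `…_one_iso(_of_conj)`)
induces `ρ : Π_A → Out(π₁^temp 𝒢)` represented by bi-continuous `Φ_a` with `(F a)^*_{θ a} ≅ B^temp(Φ_a)` (Prop 3.6
(iv) `Hom.exists_inducedHom_with` + Prop 3.2 `exists_outerAction_of_resFamily`) — the input `hrep` of
`hact_outerSemidirectProduct`. [cite: MochizukiSemiAnbd2006, Prop 5.2 (iv), p. 64] -/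
theorem exists_outerAction_of_graphActionWith
    (hmul : ∀ a b, Nonempty ((F (a * b)).chartPullbackWith (θ (a * b)) c c ≅
      (F a).chartPullbackWith (θ a) c c ⋙ (F b).chartPullbackWith (θ b) c c))
    (hone : Nonempty ((F 1).chartPullbackWith (θ 1) c c ≅ 𝟭 (BTemp c.G))) :
    ∃ ρ : PA →* TopOut c.G, ∀ a, ∃ (Φ : contMulAut c.G) (φ : c.G →ₜ* c.G),
      TopOut.mk c.G Φ = ρ a ∧ (∀ t, (Φ : MulAut c.G) t = φ t) ∧
        Nonempty ((F a).chartPullbackWith (θ a) c c ≅ BTemp.res φ) := by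
  choose φ hφ _ using fun a => (F a).exists_inducedHom_with (θ a) c c
  have hmul' : ∀ a b, Nonempty (BTemp.res (φ (a * b)) ≅ BTemp.res (φ a) ⋙ BTemp.res (φ b)) :=
    fun a b => ⟨(hφ (a * b)).some.symm ≪≫ (hmul a b).some ≪≫ NatIso.hcomp (hφ a).some (hφ b).some⟩
  have hone' : Nonempty (BTemp.res (φ 1) ≅ 𝟭 (BTemp c.G)) := ⟨(hφ 1).some.symm ≪≫ hone.some⟩
  obtain ⟨ρ, hρ⟩ := exists_outerAction_of_resFamily c.isTempered φ hmul' hone'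
  refine ⟨ρ, fun a => ?_⟩
  obtain ⟨Φ, hΦρ, hΦφ⟩ := hρ a
  exact ⟨Φ, φ a, hΦρ, hΦφ, hφ a⟩

/-- **The outer arithmetic action from a STRICT graph action**: if `F (a b) = F b ≫ F a`, `F 1 = id` in the
local presentation with the pasted / trivial 2-cells (`θ (a b) = θ b ∘ θ a`, `θ 1 = 1`), pseudo-functoriality of
the pull-backs is abc-iut-L3-d6's composition / unit law (`Hom.nonempty_chartPullbackWith_mul_iso` / `…_one_iso`):
the outer action with `(F a)^*_{θ a} ≅ B^temp(Φ_a)` exists with NO binder. [cite: MochizukiSemiAnbd2006, Prop 5.2 (iv), p. 64] -/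
theorem exists_outerAction_of_strictGraphAction
    (hab : ∀ a b, F (a * b) = (F b).comp (F a)) (hθ : ∀ a b, θ (a * b) = hab a b ▸ (θ b).comp (θ a))
    (h1 : F 1 = Hom.identity 𝒢) (hθ1 : θ 1 = h1 ▸ Hom.identityConjugators 𝒢) :
    ∃ ρ : PA →* TopOut c.G, ∀ a, ∃ (Φ : contMulAut c.G) (φ : c.G →ₜ* c.G),
      TopOut.mk c.G Φ = ρ a ∧ (∀ t, (Φ : MulAut c.G) t = φ t) ∧
        Nonempty ((F a).chartPullbackWith (θ a) c c ≅ BTemp.res φ) :=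
  exists_outerAction_of_graphActionWith c F θ
    (fun a b => Hom.nonempty_chartPullbackWith_mul_iso F θ c a b (hab a b) (hθ a b))
    (Hom.nonempty_chartPullbackWith_one_iso F θ c h1 hθ1)

/-- `H.map Φ = H.map φ` when `Φ = φ` pointwise. [folklore] -/
private theorem map_Φ_eq' (Φ : contMulAut c.G) (φ : c.G →ₜ* c.G) (hΦ : ∀ t, (Φ : MulAut c.G) t = φ t)
    (H : Subgroup c.G) : H.map (Φ : MulAut c.G).toMonoidHom = H.map φ.toMonoidHom := by
  congr 1; ext t; exact hΦ t

/-- **The three chart-compatibility binders, packaged, every-`θ` form**: from a pseudo-functorial (in the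
supplied 2-cells), locally surjective action of `Π_A` on a graph of anabelioids `𝒢` (Prop 3.6 hypotheses) there
is an outer action `ρ : Π_A →* Out(π₁^temp 𝒢)` satisfying `hV`, `hE` (`ArithTemperedGroupOfOuterAction.lean`)
and `hBR` (`ArithTemperedGroupBranchPair.lean`) with respect to the base action `a ↦ (F a).base`.
[cite: MochizukiSemiAnbd2006, Def 5.1 (i), p. 62] -/
theorem exists_outerAction_binders_of_graphActionWith (h36 : 𝒢.Prop36Hypotheses) (hG : 𝒢.graph.IsGraph)
    (hmul : ∀ a b, Nonempty ((F (a * b)).chartPullbackWith (θ (a * b)) c c ≅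
      (F a).chartPullbackWith (θ a) c c ⋙ (F b).chartPullbackWith (θ b) c c))
    (hone : Nonempty ((F 1).chartPullbackWith (θ 1) c c ≅ 𝟭 (BTemp c.G)))
    (hVs : ∀ a v, Function.Surjective ((F a).hV v)) (hEs : ∀ a e, Function.Surjective ((F a).hE e)) :
    ∃ ρ : PA →* TopOut c.G,
      (∀ (a : PA) (v : 𝒢.graph.Vertex) (H : Subgroup c.G), H ∈ verticialSubgroups c v →
        ∃ Φ : contMulAut c.G, TopOut.mk c.G Φ = ρ a ∧
          H.map (Φ : MulAut c.G).toMonoidHom ∈ verticialSubgroups c ((F a).base.vertexMap v)) ∧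
      (∀ (a : PA) (e : 𝒢.graph.Edge) (K : Subgroup c.G), K ∈ edgeLikeSubgroups c e →
        ∃ Φ : contMulAut c.G, TopOut.mk c.G Φ = ρ a ∧
          K.map (Φ : MulAut c.G).toMonoidHom ∈ edgeLikeSubgroups c ((F a).base.edgeMap e)) ∧
      (∀ (a : PA) (b : 𝒢.graph.Branch) (v : 𝒢.graph.Vertex) (hb : 𝒢.graph.abuts b = some v)
        (φᵥ : 𝒢.Gv v →ₜ* c.G), IsVerticialHom c v φᵥ →
        ∃ Φ : contMulAut c.G, TopOut.mk c.G Φ = ρ a ∧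
          ∃ φ' : 𝒢.Gv ((F a).base.vertexMap v) →ₜ* c.G,
            IsVerticialHom c ((F a).base.vertexMap v) φ' ∧ ∃ x' : c.G,
              Subgroup.map (Φ : MulAut c.G).toMonoidHom φᵥ.toMonoidHom.range =
                Subgroup.map (MulAut.conj x').toMonoidHom φ'.toMonoidHom.range ∧
              Subgroup.map (Φ : MulAut c.G).toMonoidHom
                  (Subgroup.map φᵥ.toMonoidHom (𝒢.branchSubgroup b v hb)) =
                Subgroup.map (MulAut.conj x').toMonoidHom (Subgroup.map φ'.toMonoidHom
                  (𝒢.branchSubgroup ((F a).base.branchMap b) ((F a).base.vertexMap v)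
                    ((F a).base.abuts_branchMap b v hb)))) := by
  obtain ⟨ρ, hρ⟩ := exists_outerAction_of_graphActionWith c F θ hmul hone
  refine ⟨ρ, fun a v H hH => ?_, fun a e K hK => ?_, fun a b v hb φᵥ hφᵥ => ?_⟩ <;>
    obtain ⟨Φ, φ, hΦρ, hΦφ, hiso⟩ := hρ a <;> refine ⟨Φ, hΦρ, ?_⟩ <;> simp only [map_Φ_eq' c Φ φ hΦφ]
  · exact map_mem_verticialSubgroups_of_chartPullbackWith_iso c _ _ φ hiso h36 (hVs a) hH
  · exact map_mem_edgeLikeSubgroups_of_chartPullbackWith_iso c _ _ φ hiso h36 hG (hEs a) hK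
  · exact exists_branchPair_of_chartPullbackWith_iso c _ _ φ hiso h36 (hVs a) (hEs a) b v hb φᵥ hφᵥ

/-! ### T54-B minus topology, from an action presented with 2-cell data -/

section WithBase

variable [TopologicalSpace PA] (baseAct : PA →* Aut 𝒢.graph)

/-- **The outer semi-direct product model carries the chart action, every-`θ` form**: for `𝒢` a graph of
anabelioids under the Prop 3.6 hypotheses, an action `F` of `Π_A` on `𝒢` with 2-cell data `θ`, pseudo-functorial
in those 2-cells and locally surjective, lying over `baseAct : Π_A → Aut 𝔾` with Def 5.1 (i)(c) (`hopen`), the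
derived outer action `ρ` makes `Π^temp_𝔊 := π₁^temp(𝒢) ⋊^out_ρ Π_A` satisfy abc-iut-w4-d053's
`ArithChartAction` (`arithChartAction_outerAction`). [cite: MochizukiSemiAnbd2006, Prop 5.2 (iv), p. 64] -/
theorem exists_outerAction_arithChartAction_of_graphActionWith (h36 : 𝒢.Prop36Hypotheses)
    (hG : 𝒢.graph.IsGraph) (hbase : ∀ a, (F a).base = (baseAct a).hom)
    (hmul : ∀ a b, Nonempty ((F (a * b)).chartPullbackWith (θ (a * b)) c c ≅
      (F a).chartPullbackWith (θ a) c c ⋙ (F b).chartPullbackWith (θ b) c c))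
    (hone : Nonempty ((F 1).chartPullbackWith (θ 1) c c ≅ 𝟭 (BTemp c.G)))
    (hVs : ∀ a v, Function.Surjective ((F a).hV v)) (hEs : ∀ a e, Function.Surjective ((F a).hE e))
    (hopen : ∃ U : Subgroup PA, IsOpen (U : Set PA) ∧ ∀ a ∈ U,
      (∀ v, (baseAct a).hom.vertexMap v = v) ∧ (∀ e, (baseAct a).hom.edgeMap e = e) ∧
        ∀ b, (baseAct a).hom.branchMap b = b) :
    ∃ ρ : PA →* TopOut c.G,
      ArithChartAction c (toOuterSemidirectProduct ρ) (outerSemidirectProductSnd ρ)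
        (fun a v => (baseAct a).hom.vertexMap v) (fun a e => (baseAct a).hom.edgeMap e)
        (fun a b => (baseAct a).hom.branchMap b) := by
  obtain ⟨ρ, hV, hE, -⟩ := exists_outerAction_binders_of_graphActionWith c F θ h36 hG hmul hone hVs hEs
  refine ⟨ρ, arithChartAction_outerAction c ρ baseAct ?_ ?_ hopen⟩
  · intro a v H hH
    rw [← hbase a]
    exact hV a v H hH
  · intro a e K hK
    rw [← hbase a]
    exact hE a e K hK

end WithBase

section SameUniverse

variable {PA : Type u} [Group PA] [TopologicalSpace PA] (F : PA → Hom 𝒢 𝒢)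
  (θ : ∀ a, (F a).ConjugatorFamily) (baseAct : PA →* Aut 𝒢.graph)

/-- **T54-B (GAP-LEDGER G-w4d053-1) minus the tempered topology, every-`θ` form**, in the row's existential
shape: `∃ Π^temp_𝔊, ι, aug` with `1 → π₁^temp(𝒢) → Π^temp_𝔊 → Π_A → 1` exact, `ι(π₁^temp 𝒢)` normal and
`ArithChartAction` — via `exists_arithTemperedGroup_alg`; residual inputs: pseudo-functoriality in the SUPPLIED
2-cells and local surjectivity. [cite: MochizukiSemiAnbd2006, Prop 5.2 (iv), p. 64] -/
theorem exists_arithTemperedGroup_of_graphActionWith (h36 : 𝒢.Prop36Hypotheses) (hG : 𝒢.graph.IsGraph)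
    (hbase : ∀ a, (F a).base = (baseAct a).hom)
    (hmul : ∀ a b, Nonempty ((F (a * b)).chartPullbackWith (θ (a * b)) c c ≅
      (F a).chartPullbackWith (θ a) c c ⋙ (F b).chartPullbackWith (θ b) c c))
    (hone : Nonempty ((F 1).chartPullbackWith (θ 1) c c ≅ 𝟭 (BTemp c.G)))
    (hVs : ∀ a v, Function.Surjective ((F a).hV v)) (hEs : ∀ a e, Function.Surjective ((F a).hE e))
    (hopen : ∃ U : Subgroup PA, IsOpen (U : Set PA) ∧ ∀ a ∈ U,
      (∀ v, (baseAct a).hom.vertexMap v = v) ∧ (∀ e, (baseAct a).hom.edgeMap e = e) ∧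
        ∀ b, (baseAct a).hom.branchMap b = b) :
    ∃ (Gtp : Type u) (_ : Group Gtp) (ι : c.G →* Gtp) (aug : Gtp →* PA),
      Function.Injective ι ∧ ι.range = aug.ker ∧ Function.Surjective aug ∧ ι.range.Normal ∧
        ArithChartAction c ι aug (fun a v => (baseAct a).hom.vertexMap v)
          (fun a e => (baseAct a).hom.edgeMap e) (fun a b => (baseAct a).hom.branchMap b) := by
  obtain ⟨ρ, hV, hE, -⟩ := exists_outerAction_binders_of_graphActionWith c F θ h36 hG hmul hone hVs hEs
  refine exists_arithTemperedGroup_alg c ρ baseAct h36 ?_ ?_ hopen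
  · intro a v H hH
    rw [← hbase a]
    exact hV a v H hH
  · intro a e K hK
    rw [← hbase a]
    exact hE a e K hK

/-! ### STRICT actions with pasted 2-cells: T54-B with no pull-back binder -/

/-- **T54-B minus topology from a STRICT graph action with pasted 2-cells**: `∃ Π^temp_𝔊, ι, aug` exact with
`ArithChartAction`, the only residual inputs being local surjectivity of the `A a` and Def 5.1 (i)(c) on the
base action — no pull-back binder. [cite: MochizukiSemiAnbd2006, Prop 5.2 (iv), p. 64] -/
theorem exists_arithTemperedGroup_of_strictGraphAction (h36 : 𝒢.Prop36Hypotheses) (hG : 𝒢.graph.IsGraph)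
    (hab : ∀ a b, F (a * b) = (F b).comp (F a)) (hθ : ∀ a b, θ (a * b) = hab a b ▸ (θ b).comp (θ a))
    (h1 : F 1 = Hom.identity 𝒢) (hθ1 : θ 1 = h1 ▸ Hom.identityConjugators 𝒢)
    (hbase : ∀ a, (F a).base = (baseAct a).hom)
    (hVs : ∀ a v, Function.Surjective ((F a).hV v)) (hEs : ∀ a e, Function.Surjective ((F a).hE e))
    (hopen : ∃ U : Subgroup PA, IsOpen (U : Set PA) ∧ ∀ a ∈ U,
      (∀ v, (baseAct a).hom.vertexMap v = v) ∧ (∀ e, (baseAct a).hom.edgeMap e = e) ∧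
        ∀ b, (baseAct a).hom.branchMap b = b) :
    ∃ (Gtp : Type u) (_ : Group Gtp) (ι : c.G →* Gtp) (aug : Gtp →* PA),
      Function.Injective ι ∧ ι.range = aug.ker ∧ Function.Surjective aug ∧ ι.range.Normal ∧
        ArithChartAction c ι aug (fun a v => (baseAct a).hom.vertexMap v)
          (fun a e => (baseAct a).hom.edgeMap e) (fun a b => (baseAct a).hom.branchMap b) :=
  exists_arithTemperedGroup_of_graphActionWith c F θ baseAct h36 hG hbase
    (fun a b => Hom.nonempty_chartPullbackWith_mul_iso F θ c a b (hab a b) (hθ a b))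
    (Hom.nonempty_chartPullbackWith_one_iso F θ c h1 hθ1) hVs hEs hopen

end SameUniverse

end ProfiniteSemiGraph

end Literature.AnabelianGeometry.SemiGraphs
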